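import Literature.Probability.LatticeModels.CoarseCellMixingDecay
import HarnessLib

/-!
# Exponential mixing from a coarse-cell finite-size condition: the pure (defect-free) engine

Fifth companion ("theorems only") file of
`Literature/Probability/LatticeModels/CoarseCellFiniteSize.lean`:

* `pure_engine` — if a specification `γ` on the coarse `d`-torus (`≥ 4n+3` cells per side,
  `d ≥ 1`) satisfies the good-exterior finite-size condition at `(n, ε)` with
  `2 ε · shellCount d n ≤ 1`, has NO bad configurations and exact range (`HasLeak … n 0 r`), then
  every Gibbs measure `ν` of `γ` has `|cov_ν(f,g)| ≤ 8 B_f B_g |Δf| e^{-(log 2/(2n+1)) D}` for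
  bounded measurable `f, g` depending on cells `Δf, Δg` at `ℓ^∞` cyclic distance `≥ D`
  (Dobrushin–Shlosman uniqueness-and-mixing theorem from the finite-size condition `C_V`, in the
  total-variation form, run on cells); `pure_engine_verbatim` — the same with the extra factor
  `|Δg|`;
* `pure_core_bound` — the averaged boundary-influence bound at scale `k` for a Gibbs measure,
  `∫ |γ_Λ f - ν f| dν ≤ |Δf| · ε (ε·shellCount d n)^k`;
* `half_pow_le_exp` — the geometric-to-exponential conversion used.

## References

* R. L. Dobrushin, S. B. Shlosman, *Constructive criterion for the uniqueness of Gibbs field*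
  (1985), §2–§3.
* J. van den Berg, C. Maes, Ann. Probab. 22 (1994).
* H.-O. Georgii, *Gibbs Measures and Phase Transitions*, 2nd ed. (de Gruyter 2011), §8.2.
-/

noncomputable section

open _root_.MeasureTheory
open scoped ENNReal

namespace Literature.Probability.LatticeModels

variable {d : ℕ} {μc : Fin d → ℕ} {V S : Type*} [MeasurableSpace S]

/-- **The pure-case core bound at scale `k`**: under the hypotheses of `pure_influence_decay`,
for `ν ∈ 𝒢(γ)`, a `[0,1]`-valued observable `f` of the cells `Δf`, and cells `Δg` all at
distance `> 2n + k(2n+1)` from `Δf`, the integrand of `CoreInfluenceBound` obeys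
`∫ |γ_Λ f - ν f| dν ≤ |Δf| · ε (ε·shellCount d n)^k`, `Λ :=` the sites whose cell is not in `Δg`
(even uniformly in the boundary condition: `multiCell_influence` + `pure_influence_decay`, the
ball conditions being vacuous at this distance; then DLR once). [cite: Georgii2011, §8.2] -/
theorem pure_core_bound [Fintype V] {cell : V → CoarseIdx μc}
    {γ : Specification V S} (hγ : IsSpecification γ) {good : CoarseIdx μc → Set (V → S)}
    {n : ℕ} {ε r : ℝ} (hε : 0 ≤ ε) (hFS : IsGoodFS cell γ good n ε) (hall : ∀ c σ, σ ∈ good c)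
    (hrange : HasLeak cell γ n 0 r) (hμ : ∀ i, 4 * n + 3 ≤ μc i + 1) {ν : Measure (V → S)}
    (hν : IsGibbsMeasure γ ν) (k : ℕ) (f : (V → S) → ℝ) (Δf Δg : Finset (CoarseIdx μc))
    (hf : Measurable f) (hf01 : ∀ σ, 0 ≤ f σ ∧ f σ ≤ 1) (hfdep : DependsOn f {v | cell v ∈ Δf})
    (hD : ∀ x ∈ Δf, ∀ y ∈ Δg, 2 * n + k * (2 * n + 1) < cdist x y) :
    (∀ ζ ζ' : V → S, |∫ σ, f σ ∂(γ (Finset.univ.filter fun v => cell v ∉ Δg) ζ) -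
        ∫ σ, f σ ∂(γ (Finset.univ.filter fun v => cell v ∉ Δg) ζ')| ≤
        Δf.card * (ε * (ε * shellCount d n) ^ k)) ∧
    ∫ ζ, |∫ σ, f σ ∂(γ (Finset.univ.filter fun v => cell v ∉ Δg) ζ) - ∫ σ, f σ ∂ν| ∂ν ≤
      Δf.card * (ε * (ε * shellCount d n) ^ k) := by
  haveI := hν.isProbabilityMeasure
  set Λ : Finset V := Finset.univ.filter fun v => cell v ∉ Δg with hΛ
  have hΛunion : ∀ v w, cell v = cell w → v ∈ Λ → w ∈ Λ := by
    intro v w hvw hv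
    rw [hΛ, Finset.mem_filter] at hv ⊢
    exact ⟨Finset.mem_univ _, hvw ▸ hv.2⟩
  have hoff : ∀ v, v ∉ Λ → cell v ∈ Δg := fun v hv => by
    by_contra h
    exact hv (Finset.mem_filter.2 ⟨Finset.mem_univ _, h⟩)
  have hsup : ∀ ζ ζ' : V → S, |∫ σ, f σ ∂(γ Λ ζ) - ∫ σ, f σ ∂(γ Λ ζ')| ≤
      Δf.card * (ε * (ε * shellCount d n) ^ k) := fun ζ ζ' =>
    multiCell_influence hγ (pure_influence_decay hγ hε hFS hall hrange hμ k) Δf Λ hΛunion f hf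
      hf01 hfdep ζ ζ' fun y hy v hv hd => by
        exfalso
        have h := hD y hy (cell v) (hoff v hv)
        omega
  refine ⟨hsup, ?_⟩
  set F : (V → S) → ℝ := fun ζ => ∫ σ, f σ ∂(γ Λ ζ) with hF
  have hFm : Measurable F := DobrushinShlosman.measurable_windowAvg' hγ Λ hf
  have hf1 : ∀ σ, |f σ| ≤ 1 := fun σ => by rw [abs_of_nonneg (hf01 σ).1]; exact (hf01 σ).2
  have hF1 : ∀ ζ, |F ζ| ≤ 1 := DobrushinShlosman.abs_windowAvg_le' hγ Λ hf1
  have hFi : Integrable F ν := DobrushinMetric.integrable_of_abs_le' hFm hF1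
  have hνf : ∫ σ, f σ ∂ν = ∫ ζ', F ζ' ∂ν :=
    (hν.integral_integral_eq hγ Λ (DobrushinMetric.integrable_of_abs_le' hf hf1)).symm
  have hinner : ∀ ζ, |F ζ - ∫ σ, f σ ∂ν| ≤ Δf.card * (ε * (ε * shellCount d n) ^ k) := by
    intro ζ
    rw [hνf]
    have hsub : ∫ ζ', (F ζ - F ζ') ∂ν = F ζ - ∫ ζ', F ζ' ∂ν := by
      rw [integral_sub (integrable_const _) hFi, integral_const]
      simp
    rw [← hsub]
    have h := norm_integral_le_of_norm_le_const (μ := ν)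
      (C := Δf.card * (ε * (ε * shellCount d n) ^ k)) (f := fun ζ' => F ζ - F ζ')
      (ae_of_all _ fun ζ' => by rw [Real.norm_eq_abs]; exact hsup ζ ζ')
    simpa using h
  have h := norm_integral_le_of_norm_le_const (μ := ν)
    (C := Δf.card * (ε * (ε * shellCount d n) ^ k)) (f := fun ζ => |F ζ - ∫ σ, f σ ∂ν|)
    (ae_of_all _ fun ζ => by rw [Real.norm_eq_abs, abs_abs]; exact hinner ζ)
  have habs : |∫ ζ, |F ζ - ∫ σ, f σ ∂ν| ∂ν| = ∫ ζ, |F ζ - ∫ σ, f σ ∂ν| ∂ν :=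
    abs_of_nonneg (integral_nonneg fun ζ => abs_nonneg _)
  rw [← habs]
  simpa using h

/-- Geometric-to-exponential conversion: if `D < (k+2)(2n+1)` then
`(1/2)^k ≤ 4 e^{-(log 2/(2n+1)) D}`. [folklore] -/
theorem half_pow_le_exp (n D k : ℕ) (hk : D < (k + 2) * (2 * n + 1)) :
    ((1 : ℝ) / 2) ^ k ≤ 4 * Real.exp (-(Real.log 2 / (2 * n + 1) * D)) := by
  have hpos : (0 : ℝ) < 2 * n + 1 := by positivity
  have hmono : Real.exp (-(((k + 2 : ℕ) : ℝ) * Real.log 2)) ≤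
      Real.exp (-(Real.log 2 / (2 * n + 1) * D)) := by
    rw [Real.exp_le_exp, neg_le_neg_iff, div_mul_eq_mul_div, div_le_iff₀ hpos]
    have hD : (D : ℝ) ≤ (k + 2) * (2 * n + 1) := by exact_mod_cast hk.le
    have hlog : 0 ≤ Real.log 2 := Real.log_nonneg one_le_two
    calc Real.log 2 * D ≤ Real.log 2 * ((k + 2) * (2 * n + 1)) :=
          mul_le_mul_of_nonneg_left hD hlog
      _ = ((k + 2 : ℕ) : ℝ) * Real.log 2 * (2 * n + 1) := by push_cast; ring
  have hexp : Real.exp (-(((k + 2 : ℕ) : ℝ) * Real.log 2)) = ((2 : ℝ) ^ (k + 2))⁻¹ := by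
    rw [Real.exp_neg, Real.exp_nat_mul, Real.exp_log two_pos]
  calc ((1 : ℝ) / 2) ^ k = 4 * ((2 : ℝ) ^ (k + 2))⁻¹ := by
        rw [pow_add, one_div_pow]
        field_simp
        norm_num
    _ = 4 * Real.exp (-(((k + 2 : ℕ) : ℝ) * Real.log 2)) := by rw [hexp]
    _ ≤ 4 * Real.exp (-(Real.log 2 / (2 * n + 1) * D)) :=
        mul_le_mul_of_nonneg_left hmono (by norm_num)

/-- **The engine in the pure reference case, fully proved.** If `γ` is a specification on the
coarse torus (`≥ 4n+3` cells per side) satisfying the good-exterior finite-size condition at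
`(n, ε)` with `2 ε · shellCount d n ≤ 1` and NO bad configurations, of exact range `2n+1`
(`HasLeak … n 0 r`), then every Gibbs measure `ν` of `γ` has
`|cov_ν(f,g)| ≤ 8 B_f B_g |Δf| e^{-(log 2/(2n+1)) D}` for bounded measurable `f, g` depending on
cells `Δf, Δg` at distance `≥ D` — the conclusion of `PerturbedMixingEngine` (with
`C₀ = 8`, `κₑ = log 2/(2n+1)`, and without the factor `|Δg| ≥ 1`) for `γ = γ₀`, `p = 0`.
Proof: `abs_covariance_le_integral_abs`, rescaling, and `pure_core_bound` at scale
`k = ⌊(D - 2n - 1)/(2n+1)⌋` with `ε (ε·shellCount d n)^k ≤ 2^{-k} ≤ 4 e^{-κₑ D}`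
(`half_pow_le_exp`); small `D` and `Δf = ∅` are trivial. [cite: DobrushinShlosman1985, §2] -/
theorem pure_engine [NeZero d] [Fintype V] {cell : V → CoarseIdx μc}
    {γ : Specification V S} (hγ : IsSpecification γ) {good : CoarseIdx μc → Set (V → S)}
    {n : ℕ} {ε r : ℝ} (hε : 0 ≤ ε) (hεs : 2 * ε * (shellCount d n : ℝ) ≤ 1)
    (hFS : IsGoodFS cell γ good n ε) (hall : ∀ c σ, σ ∈ good c) (hrange : HasLeak cell γ n 0 r)
    (hμ : ∀ i, 4 * n + 3 ≤ μc i + 1) {ν : Measure (V → S)} (hν : IsGibbsMeasure γ ν)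
    (f g : (V → S) → ℝ) (Δf Δg : Finset (CoarseIdx μc)) (Bf Bg : ℝ) (D : ℕ)
    (hf : Measurable f) (hg : Measurable g) (hfB : ∀ σ, |f σ| ≤ Bf) (hgB : ∀ σ, |g σ| ≤ Bg)
    (hfdep : DependsOn f {v | cell v ∈ Δf}) (hgdep : DependsOn g {v | cell v ∈ Δg})
    (hD : ∀ x ∈ Δf, ∀ y ∈ Δg, D ≤ cdist x y) :
    |∫ σ, f σ * g σ ∂ν - (∫ σ, f σ ∂ν) * ∫ σ, g σ ∂ν| ≤
      8 * Bf * Bg * Δf.card * Real.exp (-(Real.log 2 / (2 * n + 1) * D)) := by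
  haveI := hν.isProbabilityMeasure
  set Λ : Finset V := Finset.univ.filter fun v => cell v ∉ Δg with hΛ
  have hgdep' : DependsOn g ((↑Λ : Set V)ᶜ) := by
    refine fun σ τ hστ => hgdep fun v hv => hστ v ?_
    intro hvΛ
    exact (Finset.mem_filter.1 (Finset.mem_coe.1 hvΛ)).2 hv
  obtain ⟨σ₀⟩ : Nonempty (V → S) := by
    obtain ⟨σ, -⟩ := nonempty_of_measure_ne_zero (μ := ν) (s := Set.univ) (by simp)
    exact ⟨σ⟩
  have hBf : 0 ≤ Bf := (abs_nonneg _).trans (hfB σ₀)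
  have hBg : 0 ≤ Bg := (abs_nonneg _).trans (hgB σ₀)
  have hcov := abs_covariance_le_integral_abs hγ hν Λ hf hg hfB hgB hgdep'
  -- the `[0,1]`-valued core bound with exponential packaging
  have hkey : ∀ f' : (V → S) → ℝ, Measurable f' → (∀ σ, 0 ≤ f' σ ∧ f' σ ≤ 1) →
      DependsOn f' {v | cell v ∈ Δf} →
      ∫ ζ, |∫ σ, f' σ ∂(γ Λ ζ) - ∫ σ, f' σ ∂ν| ∂ν ≤
        4 * Δf.card * Real.exp (-(Real.log 2 / (2 * n + 1) * D)) := by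
    intro f' hf'm hf'01 hf'dep
    have hs1 : (1 : ℝ) ≤ shellCount d n := by exact_mod_cast one_le_shellCount n
    have hε1 : ε ≤ 1 := by nlinarith
    have hεs' : ε * shellCount d n ≤ 1 / 2 := by linarith
    by_cases hΔf : Δf = ∅
    · -- `f'` is constant
      subst hΔf
      have hconst : ∀ σ τ, f' σ = f' τ := fun σ τ =>
        hf'dep fun v hv => absurd hv (Finset.notMem_empty _)
      have hint : ∀ (μ : Measure (V → S)) [IsProbabilityMeasure μ], ∫ σ, f' σ ∂μ = f' σ₀ := by
        intro μ _
        rw [show f' = fun _ => f' σ₀ from funext fun σ => hconst σ σ₀]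
        simp
      have h0 : ∀ ζ, |∫ σ, f' σ ∂(γ Λ ζ) - ∫ σ, f' σ ∂ν| = 0 := fun ζ => by
        haveI := hγ.isProbability Λ ζ
        rw [hint (γ Λ ζ), hint ν, sub_self, abs_zero]
      simp_rw [h0]
      simp
    · have hcard : (1 : ℝ) ≤ Δf.card := by
        exact_mod_cast Finset.card_pos.2 (Finset.nonempty_iff_ne_empty.2 hΔf)
      by_cases hDsmall : D < 2 * n + 1
      · -- small distance: the trivial bound `1`
        have hexp : (1 : ℝ) / 2 ≤ Real.exp (-(Real.log 2 / (2 * n + 1) * D)) := by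
          have hpos : (0 : ℝ) < 2 * n + 1 := by positivity
          have hle : Real.log 2 / (2 * n + 1) * D ≤ Real.log 2 := by
            rw [div_mul_eq_mul_div, div_le_iff₀ hpos]
            have hD' : (D : ℝ) ≤ 2 * n + 1 := by exact_mod_cast hDsmall.le
            exact mul_le_mul_of_nonneg_left hD' (Real.log_nonneg one_le_two)
          calc (1 : ℝ) / 2 = Real.exp (-Real.log 2) := by
                rw [Real.exp_neg, Real.exp_log two_pos, one_div]
            _ ≤ _ := Real.exp_le_exp.2 (neg_le_neg hle)
        have hI1 : ∫ ζ, |∫ σ, f' σ ∂(γ Λ ζ) - ∫ σ, f' σ ∂ν| ∂ν ≤ 1 := by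
          have h := norm_integral_le_of_norm_le_const (μ := ν) (C := 1)
            (f := fun ζ => |∫ σ, f' σ ∂(γ Λ ζ) - ∫ σ, f' σ ∂ν|) (ae_of_all _ fun ζ => by
              haveI := hγ.isProbability Λ ζ
              rw [Real.norm_eq_abs, abs_abs, abs_sub_le_iff]
              obtain ⟨a0, a1⟩ := integral_mem_unitInterval (μ := γ Λ ζ) hf'm hf'01
              obtain ⟨b0, b1⟩ := integral_mem_unitInterval (μ := ν) hf'm hf'01
              constructor <;> linarith)
          have habs : |∫ ζ, |∫ σ, f' σ ∂(γ Λ ζ) - ∫ σ, f' σ ∂ν| ∂ν| =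
              ∫ ζ, |∫ σ, f' σ ∂(γ Λ ζ) - ∫ σ, f' σ ∂ν| ∂ν :=
            abs_of_nonneg (integral_nonneg fun ζ => abs_nonneg _)
          rw [← habs]
          simpa using h
        calc ∫ ζ, |∫ σ, f' σ ∂(γ Λ ζ) - ∫ σ, f' σ ∂ν| ∂ν ≤ 1 := hI1
          _ = 4 * 1 * ((1 : ℝ) / 2) / 2 := by norm_num
          _ ≤ 4 * 1 * ((1 : ℝ) / 2) := by norm_num
          _ ≤ 4 * Δf.card * Real.exp (-(Real.log 2 / (2 * n + 1) * D)) := by gcongr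
      · -- large distance: scale `k = ⌊(D - 2n - 1)/(2n+1)⌋`
        push Not at hDsmall
        set k : ℕ := (D - (2 * n + 1)) / (2 * n + 1) with hk
        have hk1 : k * (2 * n + 1) ≤ D - (2 * n + 1) := Nat.div_mul_le_self _ _
        have hk2 : D - (2 * n + 1) < k * (2 * n + 1) + (2 * n + 1) := by
          have h1 := Nat.div_add_mod (D - (2 * n + 1)) (2 * n + 1)
          have h2 := Nat.mod_lt (D - (2 * n + 1)) (show 0 < 2 * n + 1 by omega)
          have e1 : (2 * n + 1) * ((D - (2 * n + 1)) / (2 * n + 1)) = k * (2 * n + 1) := by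
            rw [← hk, mul_comm]
          rw [e1] at h1
          omega
        have hkD : 2 * n + k * (2 * n + 1) < D := by omega
        have hDk : D < (k + 2) * (2 * n + 1) := by
          have e3 : (k + 2) * (2 * n + 1) = k * (2 * n + 1) + (2 * n + 1) + (2 * n + 1) := by ring
          rw [e3]
          omega
        obtain ⟨-, hcore⟩ := pure_core_bound hγ hε hFS hall hrange hμ hν k f' Δf Δg hf'm hf'01
          hf'dep fun x hx y hy => lt_of_lt_of_le hkD (hD x hx y hy)
        have hgeo : ε * (ε * shellCount d n) ^ k ≤ ((1 : ℝ) / 2) ^ k := by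
          have hεs0 : 0 ≤ ε * shellCount d n := by positivity
          calc ε * (ε * shellCount d n) ^ k ≤ 1 * ((1 : ℝ) / 2) ^ k := by gcongr
            _ = ((1 : ℝ) / 2) ^ k := one_mul _
        have hhalf := half_pow_le_exp n D k hDk
        calc ∫ ζ, |∫ σ, f' σ ∂(γ Λ ζ) - ∫ σ, f' σ ∂ν| ∂ν
            ≤ Δf.card * (ε * (ε * shellCount d n) ^ k) := hcore
          _ ≤ Δf.card * (((1 : ℝ) / 2) ^ k) := by gcongr
          _ ≤ Δf.card * (4 * Real.exp (-(Real.log 2 / (2 * n + 1) * D))) := by gcongr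
          _ = 4 * Δf.card * Real.exp (-(Real.log 2 / (2 * n + 1) * D)) := by ring
  have hRHS : 0 ≤ 8 * Bf * Bg * Δf.card * Real.exp (-(Real.log 2 / (2 * n + 1) * D)) := by
    positivity
  rcases hBf.eq_or_lt with hBf0 | hBfpos
  · have hf0 : ∀ σ, f σ = 0 := fun σ => abs_nonpos_iff.1 (hBf0 ▸ hfB σ)
    have h0 : ∫ σ, f σ * g σ ∂ν - (∫ σ, f σ ∂ν) * ∫ σ, g σ ∂ν = 0 := by simp [hf0]
    rw [h0, abs_zero]
    exact hRHS
  · set f' : (V → S) → ℝ := fun σ => (f σ / Bf + 1) / 2 with hf'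
    have hf'm : Measurable f' := ((hf.div_const Bf).add_const 1).div_const 2
    have hf'01 : ∀ σ, 0 ≤ f' σ ∧ f' σ ≤ 1 := fun σ => by
      have h := hfB σ
      rw [abs_le] at h
      have hlo : -1 ≤ f σ / Bf := by
        rw [le_div_iff₀ hBfpos]; linarith [h.1]
      have hhi : f σ / Bf ≤ 1 := by
        rw [div_le_iff₀ hBfpos]; linarith [h.2]
      simp only [hf']
      constructor <;> linarith
    have hf'dep : DependsOn f' {v | cell v ∈ Δf} := fun σ τ hστ => by
      simp only [hf', hfdep hστ]
    have hresc := integral_abs_kernel_sub_rescale hγ (ν := ν) Λ hf hfB hBfpos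
    calc |∫ σ, f σ * g σ ∂ν - (∫ σ, f σ ∂ν) * ∫ σ, g σ ∂ν|
        ≤ Bg * ∫ ζ, |∫ σ, f σ ∂(γ Λ ζ) - ∫ σ, f σ ∂ν| ∂ν := hcov
      _ = Bg * (2 * Bf * ∫ ζ, |∫ σ, f' σ ∂(γ Λ ζ) - ∫ σ, f' σ ∂ν| ∂ν) := by rw [hresc]
      _ ≤ Bg * (2 * Bf * (4 * Δf.card * Real.exp (-(Real.log 2 / (2 * n + 1) * D)))) := by
          gcongr
          exact hkey f' hf'm hf'01 hf'dep
      _ = 8 * Bf * Bg * Δf.card * Real.exp (-(Real.log 2 / (2 * n + 1) * D)) := by ring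

/-- **The pure reference case in the verbatim shape of `PerturbedMixingEngine`'s conclusion**:
`|cov_ν(f,g)| ≤ C₀ B_f B_g |Δf| |Δg| e^{-κₑ D}` with `C₀ = 8`, `κₑ = log 2 / (2n+1)`
(`pure_engine`, and `Δg = ∅` forces `g` constant). [cite: DobrushinShlosman1985, §2] -/
theorem pure_engine_verbatim [NeZero d] [Fintype V] {cell : V → CoarseIdx μc}
    {γ : Specification V S} (hγ : IsSpecification γ) {good : CoarseIdx μc → Set (V → S)}
    {n : ℕ} {ε r : ℝ} (hε : 0 ≤ ε) (hεs : 2 * ε * (shellCount d n : ℝ) ≤ 1)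
    (hFS : IsGoodFS cell γ good n ε) (hall : ∀ c σ, σ ∈ good c) (hrange : HasLeak cell γ n 0 r)
    (hμ : ∀ i, 4 * n + 3 ≤ μc i + 1) {ν : Measure (V → S)} (hν : IsGibbsMeasure γ ν)
    (f g : (V → S) → ℝ) (Δf Δg : Finset (CoarseIdx μc)) (Bf Bg : ℝ) (D : ℕ)
    (hf : Measurable f) (hg : Measurable g) (hfB : ∀ σ, |f σ| ≤ Bf) (hgB : ∀ σ, |g σ| ≤ Bg)
    (hfdep : DependsOn f {v | cell v ∈ Δf}) (hgdep : DependsOn g {v | cell v ∈ Δg})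
    (hD : ∀ x ∈ Δf, ∀ y ∈ Δg, D ≤ cdist x y) :
    |∫ σ, f σ * g σ ∂ν - (∫ σ, f σ ∂ν) * ∫ σ, g σ ∂ν| ≤
      8 * Bf * Bg * Δf.card * Δg.card * Real.exp (-(Real.log 2 / (2 * n + 1) * D)) := by
  haveI := hν.isProbabilityMeasure
  have h := pure_engine hγ hε hεs hFS hall hrange hμ hν f g Δf Δg Bf Bg D hf hg hfB hgB hfdep
    hgdep hD
  obtain ⟨σ₀⟩ : Nonempty (V → S) := by
    obtain ⟨σ, -⟩ := nonempty_of_measure_ne_zero (μ := ν) (s := Set.univ) (by simp)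
    exact ⟨σ⟩
  have hBf : 0 ≤ Bf := (abs_nonneg _).trans (hfB σ₀)
  have hBg : 0 ≤ Bg := (abs_nonneg _).trans (hgB σ₀)
  by_cases hΔg : Δg = ∅
  · -- `g` is constant, the covariance vanishes
    subst hΔg
    have hconst : ∀ σ τ, g σ = g τ := fun σ τ =>
      hgdep fun v hv => absurd hv (Finset.notMem_empty _)
    have h1 : ∫ σ, f σ * g σ ∂ν = (∫ σ, f σ ∂ν) * g σ₀ := by
      rw [← integral_mul_const]
      exact integral_congr_ae (ae_of_all _ fun σ => by
        show f σ * g σ = f σ * g σ₀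
        rw [hconst σ σ₀])
    have h2 : ∫ σ, g σ ∂ν = g σ₀ := by
      rw [integral_congr_ae (ae_of_all _ fun σ => hconst σ σ₀)]
      simp
    have h0 : ∫ σ, f σ * g σ ∂ν - (∫ σ, f σ ∂ν) * ∫ σ, g σ ∂ν = 0 := by
      rw [h1, h2]
      ring
    rw [h0, abs_zero]
    positivity
  · have hcard : (1 : ℝ) ≤ Δg.card := by
      exact_mod_cast Finset.card_pos.2 (Finset.nonempty_iff_ne_empty.2 hΔg)
    calc _ ≤ 8 * Bf * Bg * Δf.card * Real.exp (-(Real.log 2 / (2 * n + 1) * D)) := h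
      _ = 8 * Bf * Bg * Δf.card * 1 * Real.exp (-(Real.log 2 / (2 * n + 1) * D)) := by ring
      _ ≤ 8 * Bf * Bg * Δf.card * Δg.card * Real.exp (-(Real.log 2 / (2 * n + 1) * D)) := by
          gcongr


end Literature.Probability.LatticeModels
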